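import Summits.CriticalPhenomena.CardyFormulaZ2.Theorems.CardyMagicRigidityNestingRigidityNeckCoveringA
import HarnessLib

/-!
# Crux `NestingRigidity`, line `pinch-resampling` (v4), stub S11: the arc coordinate of the hexagonal ring of `𝕋`

Crux `Summit.CriticalPhenomena.CardyFormulaZ2.Theses.CardyMagicRigidity.NestingRigidity` (stmt-CriticalPhenomena-4835),
line `pinch-resampling` v4, stub S11 `stub_neckHookupCoarseT : NeckHookupCoarseT`.  Worker W6c, wave 6: the site-`𝕋` twin of
`…NeckZ2RingArc` (worker W6a), the geometric bridge between the locales of the necklace `TNodeEventChainA` (inner-layer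
sites, on the hexagonal ring `{v | |v - x|_𝕋 = s + 1}`) and the one-dimensional gap hierarchy of `…GapHierarchy` /
`…GapEntropy`.  The hexagon `{d | |d|_𝕋 = R}` (`triNorm d = max |d 0| (max |d 1| |d 0 + d 1|)`) has `6R` sites and six
faces; its ARC COORDINATE `NeckCoarse.triArcPos R d ∈ [0, 6R)` runs from the corner `(R, 0) ↦ 0` through the faces
`d 0 = R` (`[0, R]`), `d 1 = -R` (`[R, 2R]`), `d 0 + d 1 = -R` (`[2R, 3R]`), `d 0 = -R` (`[3R, 4R]`), `d 1 = R` (`[4R, 5R]`),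
`d 0 + d 1 = R` (`[5R, 6R)`), with inverse `NeckCoarse.triArcPt R a`:

* `triArcPos_nonneg`, `triArcPos_lt` — range `[0, 6R)`; `triNorm_triArcPt`, `triArcPos_triArcPt` — `triArcPt R a` is the
  ring point of arc coordinate `a ∈ [0, 6R)`;
* `triNorm_sub_le_triArcDist`, `triNorm_sub_le_triArcDist'` — the `𝕋`-distance is at most the CYCLIC arc distance
  (`|d - d'|_𝕋 ≤ |a - a'|`, `|d - d'|_𝕋 ≤ 6R - |a - a'|`: each unit of arc is a lattice step);
* `triArcDist_le_two_mul_triNorm_sub` — conversely `min (|a - a'|, 6R - |a - a'|) ≤ 2 |d - d'|_𝕋`;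
* registered anchor `triRingArc_quasiIsometry` (the three inequalities and the inverse, packaged).

All proofs are case analyses over the faces (`split_ifs`, then `omega`).
-/

noncomputable section

namespace Summit.CriticalPhenomena.CardyFormulaZ2.Cruxes.NestingRigidity.PinchResampling

open Literature.Probability.Percolation Literature.Probability.LatticeModels

namespace NeckCoarse

/-- The hexagonal norm in coordinates. -/
theorem triNorm_eq (v : Site 2) : triNorm v = max |v 0| (max |v 1| |v 0 + v 1|) := rfl

/-- The hexagonal norm of a difference in coordinates. -/
theorem triNorm_sub (d d' : Site 2) :
    triNorm (d - d') = max |d 0 - d' 0| (max |d 1 - d' 1| |d 0 - d' 0 + (d 1 - d' 1)|) := by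
  rw [triNorm_eq]; rfl

/-- **Arc coordinate** of an offset `d` on the hexagonal ring `{|d|_𝕋 = R}`, from the corner `(R, 0)`:
face `d 0 = R ↦ -d 1 ∈ [0, R]`, face `d 1 = -R ↦ 2R - d 0 ∈ [R, 2R]`, face `d 0 + d 1 = -R ↦ 2R - d 0 ∈ [2R, 3R]`,
face `d 0 = -R ↦ 3R + d 1 ∈ [3R, 4R]`, face `d 1 = R ↦ 5R + d 0 ∈ [4R, 5R]`, face `d 0 + d 1 = R ↦ 5R + d 0 ∈ [5R, 6R)`. -/
def triArcPos (R : ℤ) (d : Site 2) : ℤ :=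
  if d 0 = R then -d 1 else if d 1 = -R then 2 * R - d 0 else if d 0 + d 1 = -R then 2 * R - d 0
    else if d 0 = -R then 3 * R + d 1 else 5 * R + d 0

/-- **Ring point of a given arc coordinate** (inverse of `triArcPos` on `[0, 6R)`). -/
def triArcPt (R a : ℤ) : Site 2 :=
  if a ≤ R then ![R, -a] else if a ≤ 2 * R then ![2 * R - a, -R] else if a ≤ 3 * R then ![2 * R - a, a - 3 * R]
    else if a ≤ 4 * R then ![-R, a - 3 * R] else if a ≤ 5 * R then ![a - 5 * R, R] else ![a - 5 * R, 6 * R - a]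

variable {R : ℤ} {d d' : Site 2}

/-- Coordinates of a ring point: `d 0, d 1, d 0 + d 1 ∈ [-R, R]`, one of them `= ±R`. -/
theorem triRing_coords (hd : triNorm d = R) :
    -R ≤ d 0 ∧ d 0 ≤ R ∧ -R ≤ d 1 ∧ d 1 ≤ R ∧ -R ≤ d 0 + d 1 ∧ d 0 + d 1 ≤ R ∧
      (d 0 = R ∨ d 0 = -R ∨ d 1 = R ∨ d 1 = -R ∨ d 0 + d 1 = R ∨ d 0 + d 1 = -R) := by
  rw [triNorm_eq] at hd
  have hR : 0 ≤ R := hd ▸ (abs_nonneg _).trans (le_max_left _ _)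
  have h0 : |d 0| ≤ R := hd ▸ le_max_left _ _
  have h1 : |d 1| ≤ R := hd ▸ (le_max_left _ _).trans (le_max_right _ _)
  have h2 : |d 0 + d 1| ≤ R := hd ▸ (le_max_right _ _).trans (le_max_right _ _)
  rw [abs_le] at h0 h1 h2
  refine ⟨h0.1, h0.2, h1.1, h1.2, h2.1, h2.2, ?_⟩
  rcases max_choice |d 0| (max |d 1| |d 0 + d 1|) with h | h <;> rw [h] at hd
  · rcases (abs_eq hR).1 hd with h' | h'
    · exact Or.inl h'
    · exact Or.inr (Or.inl h')
  · rcases max_choice |d 1| |d 0 + d 1| with h'' | h'' <;> rw [h''] at hd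
    · rcases (abs_eq hR).1 hd with h' | h'
      · exact Or.inr (Or.inr (Or.inl h'))
      · exact Or.inr (Or.inr (Or.inr (Or.inl h')))
    · rcases (abs_eq hR).1 hd with h' | h'
      · exact Or.inr (Or.inr (Or.inr (Or.inr (Or.inl h'))))
      · exact Or.inr (Or.inr (Or.inr (Or.inr (Or.inr h'))))

/-- The arc coordinate is nonnegative. -/
theorem triArcPos_nonneg (hd : triNorm d = R) : 0 ≤ triArcPos R d := by
  obtain ⟨h0, h0', h1, h1', h2, h2', hs⟩ := triRing_coords hd
  unfold triArcPos
  split_ifs <;> omega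

/-- The arc coordinate is `< 6R` (for `R ≥ 1`). -/
theorem triArcPos_lt (hR : 1 ≤ R) (hd : triNorm d = R) : triArcPos R d < 6 * R := by
  obtain ⟨h0, h0', h1, h1', h2, h2', hs⟩ := triRing_coords hd
  unfold triArcPos
  split_ifs <;> omega

/-- **`𝕋`-distance ≤ arc distance.** -/
theorem triNorm_sub_le_triArcDist (hd : triNorm d = R) (hd' : triNorm d' = R) :
    triNorm (d - d') ≤ |triArcPos R d - triArcPos R d'| := by
  obtain ⟨h0, h0', h1, h1', h2, h2', hs⟩ := triRing_coords hd
  obtain ⟨k0, k0', k1, k1', k2, k2', ks⟩ := triRing_coords hd'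
  rw [triNorm_sub, max_le_iff, max_le_iff, abs_le, abs_le, abs_le]
  simp only [le_abs, neg_le]
  unfold triArcPos
  split_ifs <;> omega

/-- **`𝕋`-distance ≤ arc distance the other way round the ring.** -/
theorem triNorm_sub_le_triArcDist' (hd : triNorm d = R) (hd' : triNorm d' = R) :
    triNorm (d - d') ≤ 6 * R - |triArcPos R d - triArcPos R d'| := by
  obtain ⟨h0, h0', h1, h1', h2, h2', hs⟩ := triRing_coords hd
  obtain ⟨k0, k0', k1, k1', k2, k2', ks⟩ := triRing_coords hd'
  rw [triNorm_sub, max_le_iff, max_le_iff, abs_le, abs_le, abs_le, abs_eq_max_neg]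
  unfold triArcPos
  split_ifs <;> omega

/-- **Cyclic arc distance ≤ twice the `𝕋`-distance.** -/
theorem triArcDist_le_two_mul_triNorm_sub (hd : triNorm d = R) (hd' : triNorm d' = R) :
    min |triArcPos R d - triArcPos R d'| (6 * R - |triArcPos R d - triArcPos R d'|) ≤ 2 * triNorm (d - d') := by
  obtain ⟨h0, h0', h1, h1', h2, h2', hs⟩ := triRing_coords hd
  obtain ⟨k0, k0', k1, k1', k2, k2', ks⟩ := triRing_coords hd'
  -- the three coordinate lower bounds of the hexagonal norm, then linear arithmetic face by face
  have e0 : |d 0 - d' 0| ≤ triNorm (d - d') := by rw [triNorm_sub]; exact le_max_left _ _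
  have e1 : |d 1 - d' 1| ≤ triNorm (d - d') := by
    rw [triNorm_sub]; exact (le_max_left _ _).trans (le_max_right _ _)
  have e2 : |d 0 - d' 0 + (d 1 - d' 1)| ≤ triNorm (d - d') := by
    rw [triNorm_sub]; exact (le_max_right _ _).trans (le_max_right _ _)
  rw [abs_le] at e0 e1 e2
  generalize triNorm (d - d') = T at e0 e1 e2
  rw [abs_eq_max_neg]
  unfold triArcPos
  split_ifs <;> omega

variable {a : ℤ}

/-- The point of arc coordinate `a ∈ [0, 6R)` lies on the ring. -/
theorem triNorm_triArcPt (ha : 0 ≤ a) (ha' : a < 6 * R) : triNorm (triArcPt R a) = R := by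
  rw [triNorm_eq]
  unfold triArcPt
  split_ifs <;>
    simp only [Matrix.cons_val_zero, Matrix.cons_val_one, Matrix.cons_val_fin_one, abs_eq_max_neg] <;> omega

/-- `triArcPos` inverts `triArcPt` below `6R`. -/
theorem triArcPos_triArcPt (ha' : a < 6 * R) : triArcPos R (triArcPt R a) = a := by
  unfold triArcPt
  split_ifs <;>
    simp only [triArcPos, Matrix.cons_val_zero, Matrix.cons_val_one, Matrix.cons_val_fin_one] <;>
    split_ifs <;> omega

/-- The ring point of arc coordinate `a` is within `𝕋`-distance `|a - triArcPos d|` of the ring point `d`. -/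
theorem triNorm_triArcPt_sub_le (hd : triNorm d = R) (ha : 0 ≤ a) (ha' : a < 6 * R) :
    triNorm (triArcPt R a - d) ≤ |a - triArcPos R d| := by
  have h := triNorm_sub_le_triArcDist (triNorm_triArcPt ha ha') hd
  rwa [triArcPos_triArcPt ha'] at h

end NeckCoarse

/-- **The arc coordinate of the hexagonal ring is a quasi-isometry onto the cycle `ℤ/6R` (registered helper, anchor of this
module on the crux item).**  For offsets `d, d'` on the ring `{|·|_𝕋 = R}`: `|d - d'|_𝕋 ≤ |a - a'|`,
`|d - d'|_𝕋 ≤ 6R - |a - a'|` and `min (|a - a'|) (6R - |a - a'|) ≤ 2 |d - d'|_𝕋` where `a = triArcPos R d`,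
`a' = triArcPos R d'`; and every `a ∈ [0, 6R)` is the arc coordinate of the ring point `triArcPt R a`. -/
theorem triRingArc_quasiIsometry : ∀ (R : ℤ) (d d' : Site 2), triNorm d = R → triNorm d' = R → (triNorm (d - d') ≤ |NeckCoarse.triArcPos R d - NeckCoarse.triArcPos R d'| ∧ triNorm (d - d') ≤ 6 * R - |NeckCoarse.triArcPos R d - NeckCoarse.triArcPos R d'| ∧ min |NeckCoarse.triArcPos R d - NeckCoarse.triArcPos R d'| (6 * R - |NeckCoarse.triArcPos R d - NeckCoarse.triArcPos R d'|) ≤ 2 * triNorm (d - d')) ∧ ∀ a : ℤ, 0 ≤ a → a < 6 * R → triNorm (NeckCoarse.triArcPt R a) = R ∧ NeckCoarse.triArcPos R (NeckCoarse.triArcPt R a) = a :=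
  fun _ _ _ hd hd' ↦ ⟨⟨NeckCoarse.triNorm_sub_le_triArcDist hd hd', NeckCoarse.triNorm_sub_le_triArcDist' hd hd',
    NeckCoarse.triArcDist_le_two_mul_triNorm_sub hd hd'⟩,
    fun _ ha ha' ↦ ⟨NeckCoarse.triNorm_triArcPt ha ha', NeckCoarse.triArcPos_triArcPt ha'⟩⟩

end Summit.CriticalPhenomena.CardyFormulaZ2.Cruxes.NestingRigidity.PinchResampling

end
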